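import Literature.Analysis.PDE.PoissonBall
import Literature.Analysis.FluidPDE.TsaiSelfSimilarBounded
import Literature.Analysis.FluidPDE.DistributionalPressurePoisson
import HarnessLib

/-!
# Harmonic functions on `ℝⁿ` are smooth; Liouville for harmonic functions whose gradient vanishes at
# infinity

Analysis/PDE support file (all results PROVED; no definitions, no named facts), salvage seat
ns-claims-salvage-p1 (cell ns-claims, D-0090). Two classical facts, assembled from the tree's Poisson
integral on balls (`PoissonBall.eq_poisson_of_harmonic`, `PoissonBall.contDiffOn_poisson`; Gilbarg–Trudinger
Thm 2.6) and Liouville's theorem for bounded harmonic maps (`isConst_of_harmonic_bounded_inner`,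
Gilbarg–Trudinger Thm 2.10):

* `contDiff_of_harmonicOnNhd_univ` — a harmonic function `h : E → ℝ` on a nontrivial finite-dimensional
  real inner product space is `C^∞` (interior regularity: `h` is the Poisson integral of its own values on
  every ball, and Poisson integrals are smooth inside) [cite: GilbargTrudinger2001, Thm 2.6 and (2.22)–(2.23)];
* (private helper) a continuous function tending to `0` along the cocompact filter is bounded;
* `isConst_of_harmonic_of_tendsto_gradient` — **Liouville, gradient form**: a `C²` function with
  `Δq = 0` on all of `E` and `∇q → 0` at infinity is constant (`∇q` is a bounded harmonic map, hence
  constant, hence `0`) [cite: GilbargTrudinger2001, Thm 2.10].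

Typed consumer on the NS-CLAIMS map: C113 `Baev2022` Step 2 (`Literature.Claims.NS.Baev2022.NeumannLiouville`:
«Δp = 0, ∇p|_∞ = 0 ⟹ p = const», p.15 / Cor. 1 (15) p.9), which is exactly the third item on `ℝ³`.

WHAT THIS IS NOT: not a claim about NS regularity or blow-up; not a claim about any author beyond the typed
locator.
-/

noncomputable section

open MeasureTheory Set Filter Topology InnerProductSpace Metric
open scoped Laplacian ContDiff

namespace Literature.Analysis.PDE

variable {E : Type*} [NormedAddCommGroup E] [InnerProductSpace ℝ E] [FiniteDimensional ℝ E]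
  [MeasurableSpace E] [BorelSpace E]

/-- **Harmonic functions are smooth.** A function harmonic on all of a nontrivial finite-dimensional real
inner product space is `C^∞`: on each unit ball it coincides with the Poisson integral of its values on the
sphere, which is smooth in the open ball. [cite: GilbargTrudinger2001, Thm 2.6] -/
theorem contDiff_of_harmonicOnNhd_univ [Nontrivial E] {h : E → ℝ} (hh : HarmonicOnNhd h univ) :
    ContDiff ℝ ∞ h := by
  have hn : 0 < Module.finrank ℝ E := Module.finrank_pos
  have hcont : Continuous h :=
    continuous_iff_continuousAt.2 fun x => (hh x (mem_univ x)).1.continuousAt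
  refine contDiff_iff_contDiffAt.2 fun c => ?_
  have hrep : ∀ x ∈ closedBall c 1, h x = PoissonBall.poisson c 1 h x :=
    PoissonBall.eq_poisson_of_harmonic hn one_pos hcont.continuousOn
      (fun x _ => (hh x (mem_univ x)).1) (fun x _ => (hh x (mem_univ x)).2.eq_of_nhds)
  have hP : ContDiffOn ℝ ∞ (PoissonBall.poisson c 1 h) (ball c 1) :=
    PoissonBall.contDiffOn_poisson one_pos hcont.continuousOn
  have hOn : ContDiffOn ℝ ∞ h (ball c 1) :=
    hP.congr fun x hx => hrep x (ball_subset_closedBall hx)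
  exact hOn.contDiffAt (isOpen_ball.mem_nhds (mem_ball_self one_pos))

omit [InnerProductSpace ℝ E] [FiniteDimensional ℝ E] [MeasurableSpace E] [BorelSpace E] in
/-- A continuous function tending to `0` along the cocompact filter is bounded. [folklore] -/
private theorem exists_bound_norm_of_tendsto_cocompact {X : Type*} [TopologicalSpace X] {F : Type*}
    [NormedAddCommGroup F] {g : X → F} (hg : Continuous g) (h0 : Tendsto g (cocompact X) (𝓝 0)) :
    ∃ C : ℝ, ∀ x, ‖g x‖ ≤ C := by
  have h1 : ∀ᶠ x in cocompact X, dist (g x) 0 < 1 := Metric.tendsto_nhds.1 h0 1 one_pos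
  obtain ⟨K, hK, hKsub⟩ := mem_cocompact.1 h1
  obtain ⟨B, hB⟩ := hK.exists_bound_of_continuousOn hg.continuousOn
  refine ⟨max B 1, fun x => ?_⟩
  by_cases hx : x ∈ K
  · exact (hB x hx).trans (le_max_left _ _)
  · have h := hKsub hx
    simp only [mem_setOf_eq, dist_zero_right] at h
    exact h.le.trans (le_max_right _ _)

/-- **Liouville's theorem, gradient form.** A `C²` function `q : E → ℝ` with `Δq = 0` everywhere whose
gradient tends to `0` at infinity is constant: `q` is harmonic, hence smooth; `∇q` is then a harmonic map
(`Δ∇q = ∇Δq = 0`), continuous and vanishing at infinity, hence bounded, hence constant by Liouville, hence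
`≡ 0`; so `Dq ≡ 0` and `q` is constant. [cite: GilbargTrudinger2001, Thm 2.10] -/
theorem isConst_of_harmonic_of_tendsto_gradient [Nontrivial E] {q : E → ℝ} (hq : ContDiff ℝ 2 q)
    (hΔ : ∀ x, Δ q x = 0) (hg : Tendsto (gradient q) (cocompact E) (𝓝 0)) (x y : E) : q x = q y := by
  have hΔ0 : Δ q = 0 := funext hΔ
  have hharm : HarmonicOnNhd q univ := fun z _ => ⟨hq.contDiffAt, by rw [hΔ0]⟩
  have hsm : ContDiff ℝ ∞ q := contDiff_of_harmonicOnNhd_univ hharm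
  have h3 : ContDiff ℝ 3 q := contDiff_infty.1 hsm 3
  haveI : CompleteSpace E := FiniteDimensional.complete ℝ E
  have hG2 : ContDiff ℝ 2 (gradient q) := by
    have e1 : gradient q = fun z => (InnerProductSpace.toDual ℝ E).symm (fderiv ℝ q z) := rfl
    rw [e1]
    exact (InnerProductSpace.toDual ℝ E).symm.toContinuousLinearEquiv.contDiff.comp
      (h3.fderiv_right (m := 2) (by norm_cast))
  have hΔG : Δ (gradient q) = 0 := by
    funext z
    rw [Literature.Analysis.FluidPDE.laplacian_gradient h3 z, hΔ0]
    simp [Pi.zero_def]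
  have hGharm : HarmonicOnNhd (gradient q) univ := fun z _ => ⟨hG2.contDiffAt, by rw [hΔG]⟩
  obtain ⟨C, hC⟩ := exists_bound_norm_of_tendsto_cocompact hG2.continuous hg
  have hconst := Literature.Analysis.FluidPDE.isConst_of_harmonic_bounded_inner hGharm ⟨C, hC⟩
  have h0 : gradient q 0 = 0 := by
    have e : gradient q = fun _ => gradient q 0 := funext fun z => hconst z 0
    rw [e] at hg
    exact tendsto_nhds_unique tendsto_const_nhds hg
  have hD : ∀ z, fderiv ℝ q z = 0 := fun z => by
    have hz : gradient q z = 0 := (hconst z 0).trans h0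
    have h1 : fderiv ℝ q z = (InnerProductSpace.toDual ℝ E) (gradient q z) := by
      simp [gradient]
    rw [h1, hz, map_zero]
  exact is_const_of_fderiv_eq_zero (hq.differentiable (by norm_num)) hD x y

end Literature.Analysis.PDE

end

-- WHAT THIS IS NOT: not a claim about NS regularity or blow-up; not a claim about any author beyond the typed locator.
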